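import Literature.AlgebraicGeometry.AbelianSchemes.SerreTensorIntegralIdealCoverKernel
import Literature.AlgebraicGeometry.AbelianSchemes.SerreTensorIntegralIdealCover
import Literature.AlgebraicGeometry.AbelianSchemes.AbelianSchemeHomDescentKernelEq
import Literature.AlgebraicGeometry.AbelianSchemes.AbelianSchemeHomDescentPolarized
import HarnessLib

/-!
# UNTWISTING: an `𝒪`-equivariant isomorphism `A ⊗_𝒪 𝔟 ≅ A″ ⊗_𝒪 𝔟` of Serre tensors DESCENDS to an `𝒪`-equivariant isomorphism `A ≅ A″`
# compatible with the covers `ψ′` and the translates `ψ_P` (any base; `𝔟 ⊇ 𝒪` invertible, presented with a quasi-inverse up to `N ≠ 0`)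

Topic `Literature/AlgebraicGeometry/AbelianSchemes`, namespace `Literature.AlgebraicGeometry.AbelianSchemes.AbelianSchemeOver`.  THEOREMS ONLY (no definition,
no named fact, no `instance`, no notation, no `sorry`); ANY base scheme `S`.  Cell `hodgecm-mathlib` (D-0151), FLOOR 0, P6 «MOD programme» (crux hLiu418 =
stmt-HodgeConjecture-24832, `--supports`, count-neutral), σ2 (β′) lineage of `stub_HFROB`, organ **σ2-GLUE-C «UNTWIST»**: in the HFROB ← `frob₀` derivation
(card J10) the roof leg gives `e′ : A_x̄^{(q)} ≅ A_x̄″ ⊗ 𝔞⁻¹` (★ `FrobeniusTwistOfRoof`) and the cover leg gives `A_x̄^{(q)} ≅ A_{x̄′} ⊗ 𝔞⁻¹` (★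
`SerreTensorRecognitionOfPoints` §3 on the kernel clause (f1′) of `FrobCover₀`), whence an `𝒪`-equivariant isomorphism `g : A_{x̄′} ⊗ 𝔞⁻¹ ≅ A_x̄″ ⊗ 𝔞⁻¹`;
THIS file descends such a `g` to **`f : A_{x̄′} ≅ A_x̄″`**, `𝒪`-equivariant, with `ψ′ ≫ f = g ≫ ψ′″` (covers) and `ψ_P ≫ g = f ≫ ψ″_P` (translates) — the
`A`-part of the exact tuple isomorphism HFROB needs before `inj₀`.  METHOD (rank-free descent): the cover `ψ′ = (A ⊗ Q) ≫ (A ⊗ 𝒪 ≅ A) : A ⊗ 𝔟 → A` (★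
`serreTranslateInv`, finite flat surjective) has kernel `(A ⊗ 𝔟)[𝔠]` for the set of scalars `𝔠` carried by `Q` (★ `SerreTensorIntegralIdealCoverKernel`) —
an `𝒪`-INTRINSIC subgroup functor, hence carried by the equivariant `g` onto the kernel of `ψ′″`; so `ψ′` and `g ≫ ψ′″` are fppf homomorphisms out of
`A ⊗ 𝔟` with the SAME kernel and ★ `AbelianSchemeHomDescentKernelEq` produces `f` ([MumfordAV1970] §7 Thm. 4; [SGA1] VIII 5.2); the translate law follows
by cancelling `[N]` (★ `cancel_right_of_comp_eq_pow_id`).  HC_CM is proved only modulo the 2 remaining named inputs (hLiu418, h413) until rung 0 closes; this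
file discharges none of them.

## Contents (`act : 𝒪 → End A`, `act″ : 𝒪 → End A″`; ONE presentation `(E′, P, Q, N)` of `𝔟` used on both sides; `𝔠 : Set 𝒪` the cover's scalar set)
* §1 `comp_iso_hom_eq_one_iff'` (`x ≫ g = 1 ↔ x = 1`), `comp_serreTranslateInv_eq_one_iff_of_equivariant_iso` (the kernel of `ψ′` is carried by `g`).
* §2 **`exists_iso_of_equivariant_serreTensor_iso`** — the head: `∃ f : A ≅ A″`, `IsMonHom`, `𝒪`-equivariant, `ψ′ ≫ f = g ≫ ψ′″`, unique;
  **`serreTranslate_comp_eq_comp_serreTranslate_of_cover`** — then `ψ_P ≫ g = f ≫ ψ″_P`.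

## References
* [MumfordAV1970] D. Mumford, *Abelian Varieties* (1970), §7 Thm. 4 (p. 72).
* [Conrad2004GrossZagier] B. Conrad, *Gross–Zagier revisited*, MSRI Publ. 49 (2004), §7 (Thm. 7.5).
* [MilneCM2006] J. S. Milne, *Complex Multiplication* (2006), §7 (Def. 7.19, Prop. 7.22, Rem. 7.23).
* [SGA1] A. Grothendieck, *SGA 1*, Exp. VIII Thm. 5.2.
-/

noncomputable section

universe u

open CategoryTheory CategoryTheory.Limits AlgebraicGeometry MonoidalCategory CartesianMonoidalCategory
open scoped MonObj

namespace Literature.AlgebraicGeometry.AbelianSchemes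

namespace AbelianSchemeOver

variable {S : Scheme.{u}} {A A'' : AbelianSchemeOver S} {O : Type*} [CommRing O] (act : A.RingAction O) (act'' : A''.RingAction O)
  [IsCommMonObj A.X] [IsCommMonObj A''.X]
  {m : ℕ} (E' : Matrix (Fin m) (Fin m) O) (hE' : E' * E' = E') (P : Matrix (Fin m) (Fin 1) O) (Q : Matrix (Fin 1) (Fin m) O) {N : ℕ}

/-! ## §1 The kernel of the cover is intrinsic -/

omit [IsCommMonObj A.X] [IsCommMonObj A''.X] in
/-- `x ≫ g = 1 ↔ x = 1` for an isomorphism `g` of group objects with `g.hom`, hence `g.inv`, a homomorphism. [cite: MumfordAV1970, §7 Thm. 4 (p. 72)] -/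
theorem comp_iso_hom_eq_one_iff' {Y Z : Over S} [GrpObj Y] [GrpObj Z] (g : Y ≅ Z) [IsMonHom g.hom] {T : Over S} (x : T ⟶ Y) :
    x ≫ g.hom = 1 ↔ x = 1 := by
  constructor
  · intro h
    rw [← Category.comp_id x, ← g.hom_inv_id, ← Category.assoc, h, MonObj.one_comp]
  · intro h
    rw [h, MonObj.one_comp]

include hE' in
/-- **THE KERNEL OF THE COVER IS CARRIED BY ANY EQUIVARIANT ISOMORPHISM**: for `g : A ⊗ 𝔟 ≅ A″ ⊗ 𝔟` intertwining the Serre actions,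
`t ≫ ψ′ = 1 ↔ (t ≫ g) ≫ ψ′″ = 1` — both sides say «`t` is killed by every scalar of `𝔠`» (★ `comp_serreTranslateInv_eq_one_iff_forall_comp_serreAction_i_eq_one`).
[cite: Conrad2004GrossZagier, §7 (Thm. 7.5)] [cite: MumfordAV1970, §7 Thm. 4 (p. 72)] -/
theorem comp_serreTranslateInv_eq_one_iff_of_equivariant_iso (hQ : Q * E' = Q) (𝔠 : Set O) (hQ𝔠 : ∀ j k, Q j k ∈ 𝔠)
    (h𝔠 : ∀ a ∈ 𝔠, ∃ Pa : Matrix (Fin m) (Fin 1) O, E' * Pa = Pa ∧ Pa * Q = a • E')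
    (g : (serreTensor act E' hE').X ≅ (serreTensor act'' E' hE').X) [IsMonHom g.hom]
    (hg : ∀ a, (serreAction act E' hE').i a ≫ g.hom = g.hom ≫ (serreAction act'' E' hE').i a)
    {T : Over S} (t : T ⟶ (serreTensor act E' hE').X) :
    t ≫ serreTranslateInv act E' hE' Q = 1 ↔ t ≫ (g.hom ≫ serreTranslateInv act'' E' hE' Q) = 1 := by
  rw [comp_serreTranslateInv_eq_one_iff_forall_comp_serreAction_i_eq_one act E' hE' Q hQ 𝔠 hQ𝔠 h𝔠 t, ← Category.assoc,
    comp_serreTranslateInv_eq_one_iff_forall_comp_serreAction_i_eq_one act'' E' hE' Q hQ 𝔠 hQ𝔠 h𝔠 (t ≫ g.hom)]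
  refine forall₂_congr fun a _ => ?_
  rw [Category.assoc, ← hg a, ← Category.assoc, comp_iso_hom_eq_one_iff']

/-! ## §2 Untwisting -/

include hE' in
/-- **UNTWISTING AN EQUIVARIANT ISOMORPHISM OF SERRE TENSORS**: `𝔟 = E′𝒪ᵐ` presented with `P` (`E′P = P`), the functional `Q` (`QE′ = Q`) and `QP = N`,
`PQ = N·E′`, `N ≠ 0`; `𝔠` a set of scalars containing the entries of `Q`, each presented against `Q`.  For every isomorphism `g : A ⊗_𝒪 𝔟 ≅ A″ ⊗_𝒪 𝔟` of
`S`-schemes with `g.hom` a homomorphism intertwining the Serre actions there is a UNIQUE `f : A ≅ A″` with **`ψ′ ≫ f = g ≫ ψ′″`** (covers ★ `serreTranslateInv`);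
`f.hom` is a homomorphism and `𝒪`-EQUIVARIANT (`ι(a) ≫ f = f ≫ ι″(a)`). [cite: MumfordAV1970, §7 Thm. 4 (p. 72)] [cite: Conrad2004GrossZagier, §7 (Thm. 7.5)]
[cite: MilneCM2006, §7 (Def. 7.19, Prop. 7.22, Rem. 7.23)] -/
theorem exists_iso_of_equivariant_serreTensor_iso (hN : N ≠ 0) (hP : E' * P = P) (hQ : Q * E' = Q)
    (hQP : Q * P = Matrix.scalar (Fin 1) (N : O)) (hPQ : P * Q = Matrix.scalar (Fin m) (N : O) * E')
    (𝔠 : Set O) (hQ𝔠 : ∀ j k, Q j k ∈ 𝔠) (h𝔠 : ∀ a ∈ 𝔠, ∃ Pa : Matrix (Fin m) (Fin 1) O, E' * Pa = Pa ∧ Pa * Q = a • E')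
    (g : (serreTensor act E' hE').X ≅ (serreTensor act'' E' hE').X) [IsMonHom g.hom]
    (hg : ∀ a, (serreAction act E' hE').i a ≫ g.hom = g.hom ≫ (serreAction act'' E' hE').i a) :
    ∃ f : A.X ≅ A''.X, IsMonHom f.hom ∧ (∀ a, act.i a ≫ f.hom = f.hom ≫ act''.i a) ∧
      serreTranslateInv act E' hE' Q ≫ f.hom = g.hom ≫ serreTranslateInv act'' E' hE' Q ∧
        ∀ f' : A.X ⟶ A''.X, serreTranslateInv act E' hE' Q ≫ f' = g.hom ≫ serreTranslateInv act'' E' hE' Q → f' = f.hom := by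
  haveI := isMonHom_serreTranslateInv act E' hE' Q
  haveI := isMonHom_serreTranslateInv act'' E' hE' Q
  haveI := isFinite_serreTranslateInv_left act E' hE' Q P hN hP hQ hQP hPQ
  haveI := flat_serreTranslateInv_left act E' hE' Q P hN hP hQ hQP hPQ
  haveI := surjective_serreTranslateInv_left act E' hE' Q P hN hP hQ hQP hPQ
  haveI := isFinite_serreTranslateInv_left act'' E' hE' Q P hN hP hQ hQP hPQ
  haveI := flat_serreTranslateInv_left act'' E' hE' Q P hN hP hQ hQP hPQ
  haveI := surjective_serreTranslateInv_left act'' E' hE' Q P hN hP hQ hQP hPQ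
  haveI : Flat (g.hom ≫ serreTranslateInv act'' E' hE' Q).left := by rw [Over.comp_left]; infer_instance
  haveI : Surjective (g.hom ≫ serreTranslateInv act'' E' hE' Q).left := by rw [Over.comp_left]; infer_instance
  haveI : QuasiCompact (g.hom ≫ serreTranslateInv act'' E' hE' Q).left := by rw [Over.comp_left]; infer_instance
  obtain ⟨f, hf, hmon, hequiv, huniq⟩ := exists_iso_comp_eq_equivariant_of_comp_eq_one_iff (A := serreTensor act E' hE')
    (serreTranslateInv act E' hE' Q) (g.hom ≫ serreTranslateInv act'' E' hE' Q) (serreAction act E' hE') act'' act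
    (fun a => i_comp_serreTranslateInv act E' hE' Q hQ a)
    (fun a => by rw [← Category.assoc, hg a, Category.assoc, i_comp_serreTranslateInv act'' E' hE' Q hQ a, Category.assoc])
    (fun T t => comp_serreTranslateInv_eq_one_iff_of_equivariant_iso act act'' E' hE' Q hQ 𝔠 hQ𝔠 h𝔠 g hg t)
  exact ⟨f, hmon, hequiv, hf, huniq⟩

include hE' in
/-- **… AND THE TRANSLATES MATCH**: for the `f` of `exists_iso_of_equivariant_serreTensor_iso` (indeed for any homomorphism `f` with `ψ′ ≫ f = g ≫ ψ′″`),
`ψ_P ≫ g = f ≫ ψ″_P` (both followed by the cover `ψ′″` give `[N] ≫ f = f ≫ [N]`; cancel `[N]`, ★ `cancel_right_of_comp_eq_pow_id`).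
[cite: MumfordAV1970, §7 Thm. 4 (p. 72)] [cite: Conrad2004GrossZagier, §7 (Thm. 7.5)] -/
theorem serreTranslate_comp_eq_comp_serreTranslate_of_cover (hN : N ≠ 0) (hP : E' * P = P) (hQ : Q * E' = Q)
    (hQP : Q * P = Matrix.scalar (Fin 1) (N : O)) (hPQ : P * Q = Matrix.scalar (Fin m) (N : O) * E')
    (g : (serreTensor act E' hE').X ⟶ (serreTensor act'' E' hE').X) [IsMonHom g]
    (f : A.X ⟶ A''.X) [IsMonHom f] (hf : serreTranslateInv act E' hE' Q ≫ f = g ≫ serreTranslateInv act'' E' hE' Q) :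
    serreTranslate act E' hE' P ≫ g = f ≫ serreTranslate act'' E' hE' P := by
  haveI := isMonHom_serreTranslate act E' hE' P
  haveI := isMonHom_serreTranslate act'' E' hE' P
  haveI := isMonHom_serreTranslateInv act'' E' hE' Q
  refine cancel_right_of_comp_eq_pow_id A (serreTranslateInv act'' E' hE' Q) (serreTranslate act'' E' hE' P) hN
    (serreTranslateInv_comp_serreTranslate act'' E' hE' P Q hP hQ hPQ) _ _ ?_
  rw [Category.assoc, ← hf, ← Category.assoc, serreTranslate_comp_serreTranslateInv act E' hE' P Q hP hQ hQP, Category.assoc,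
    serreTranslate_comp_serreTranslateInv act'' E' hE' P Q hP hQ hQP, comp_pow_id_eq_pow_id_comp A f N]

end AbelianSchemeOver

end Literature.AlgebraicGeometry.AbelianSchemes

end
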